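import Literature.Algebra.Homology.DiscreteRepInflationQuotient
import Literature.Algebra.Homology.DiscreteRepStandardResolution
import Literature.Algebra.Homology.DiscreteRepRestrictionExact
import HarnessLib

/-!
# `N`-invariants of DISCRETE representations as discrete representations of `Γ ⧸ N` for an arbitrary normal
# subgroup `N` (e.g. closed, non-open: `G_S = Γ_K ⧸ N_S`): the functor `C_Γ ⥤ C_{Γ/N}`, its exactness on modules
# with trivial `N`-action, and the counit `Inf(X^N) ⟶ X`

Topic `Algebra/Homology`; namespace `Literature.Algebra.Homology.DiscreteRep`; sequel to
`DiscreteRepInflationQuotient.lean` (`inflQuotFunctor k N : C_{Γ/N} ⥤ C_Γ`, the inflation of DISCRETE representations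
along `Γ ↠ Γ ⧸ N` for any normal `N`) and `DiscreteRepInflation.lean` (`invariantsQuotFunctor k U : C_Γ ⥤ Rep k (Γ ⧸ U)`,
`homInfEquiv`, valid for any normal `U`).  Definitions with bodies and theorems; no named fact, no `sorry`, no instance,
no notation.

For a topological group `Γ`, a normal subgroup `N` (quotient topology on `Γ ⧸ N`) and `X ∈ C_Γ` (a representation with
open stabilisers):

* `preimage_coe_stabilizer_quotientToInvariants`, **`isDiscrete_quotientToInvariants`** — the stabiliser in `Γ ⧸ N`
  of an `N`-invariant vector has preimage its (open) stabiliser in `Γ`, so `X^N` is a DISCRETE `Γ ⧸ N`-module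
  (Serre I §2.6: "`A^H` is a `G/H`-module");
* **`invariantsQuotD k N : DiscreteRepCat k Γ ⥤ DiscreteRepCat k (Γ ⧸ N)`**, `X ↦ X^N` (the lift of
  `invariantsQuotFunctor` to the full subcategory; `invariantsQuotDCompιIso`, `invariantsQuotD_obj_obj`,
  `invariantsQuotD_map_hom_hom_coe` — all `rfl`);
* `exact_apply`, `shortExact_f_injective`, `shortExact_g_surjective`, `shortComplex_g_f_apply` — elementwise reading of
  (short) exactness in `C_Γ` for any `Γ`, `k` (the `Γ = Γ_K`, `k = ℤ` case is `DGMBridge.exact_apply` &c.);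
* **`shortExact_map_invariantsQuotD`** — for a short exact `0 → X₁ → X₂ → X₃ → 0` in `C_Γ` with `N` acting trivially on
  `X₂` (hence on `X₁`, `X₃`), `0 → X₁^N → X₂^N → X₃^N → 0` is short exact in `C_{Γ/N}` (all three invariant modules are
  the whole modules);
* **`invariantsInclQuot N X : (inflQuotFunctor k N).obj ((invariantsQuotD k N).obj X) ⟶ X`** — the counit `Inf(X^N) ⊆ X`
  (`homInfOfInvariants` of `𝟙`), `rfl` formula, mono, natural (`invariantsInclQuot_naturality`), and surjective — hence
  an isomorphism, `isIso_invariantsInclQuot` — when `N` acts trivially on `X`.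

Written for lane «PT-Ш-S-TC» of crux `GoodLatticeBDPValue` (cell bsd-eis, item 19032; brick D4a: the `S`-presentation of a
finite `G_S`-module is the `N_S`-invariants of its canonical `Γ_K`-presentation, and D4b reads `G_S`-morphisms out of it
through `inflQuotFunctor`).  HONEST FRAMING: category bookkeeping only; nothing arithmetic is proved here.

## References
* J.-P. Serre, *Galois Cohomology*, Springer (1997), I §2.6 (the `G/H`-module `A^H`). [SerreGaloisCohomology1997]
* D. Harari, *Galois Cohomology and Class Field Theory*, Universitext (2020), §4.2 Def. 4.14, §4.3 Remark 4.24. [Harari2020]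
-/

noncomputable section

universe u

namespace Literature.Algebra.Homology

namespace DiscreteRep

open CategoryTheory CategoryTheory.Limits

variable {k Γ : Type u} [CommRing k] [Group Γ] [TopologicalSpace Γ] (N : Subgroup Γ) [N.Normal]

/-! ## §1 `X^N` is a discrete `Γ ⧸ N`-module -/

omit [TopologicalSpace Γ] in
/-- The preimage under `Γ → Γ ⧸ N` of the stabiliser of `w ∈ X^N` in `Γ ⧸ N` is the stabiliser of `w` in `Γ`.
[cite: SerreGaloisCohomology1997, I §2.6] -/
theorem preimage_coe_stabilizer_quotientToInvariants (A : Rep.{u} k Γ) (w : (A.quotientToInvariants N).V) :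
    (QuotientGroup.mk : Γ → Γ ⧸ N) ⁻¹' (stabilizer (A.quotientToInvariants N) w : Set (Γ ⧸ N)) =
      (stabilizer A w.1 : Set Γ) := by
  ext g
  simp only [Set.mem_preimage, SetLike.mem_coe, mem_stabilizer_iff]
  exact ⟨fun h => congrArg Subtype.val h, fun h => Subtype.ext h⟩

variable [IsTopologicalGroup Γ]

/-- **`X^N` is a discrete `Γ ⧸ N`-module when `X` is a discrete `Γ`-module** (any normal `N`, quotient topology): the
stabiliser of `w` is the image of the open stabiliser of `w` under the open map `Γ → Γ ⧸ N`.
[cite: SerreGaloisCohomology1997, I §2.6] [cite: Harari2020, §4.2 Def. 4.14] -/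
theorem isDiscrete_quotientToInvariants (A : Rep.{u} k Γ) (hA : IsDiscrete A) :
    IsDiscrete (A.quotientToInvariants N) := fun w => by
  have h := (QuotientGroup.isOpenMap_coe (N := N)) _
    ((preimage_coe_stabilizer_quotientToInvariants N A w).symm ▸ hA w.1)
  rwa [Set.image_preimage_eq _ QuotientGroup.mk_surjective] at h

/-! ## §2 The functor `X ↦ X^N : C_Γ ⥤ C_{Γ/N}` -/

variable (k) in
/-- **`N`-invariants `C_Γ ⥤ C_{Γ/N}`**, `X ↦ X^N` with its `Γ ⧸ N`-action (the tree's `invariantsQuotFunctor` lifted to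
the full subcategory of discrete representations). [cite: SerreGaloisCohomology1997, I §2.6] [cite: Harari2020, §4.3 Remark 4.24] -/
def invariantsQuotD : DiscreteRepCat k Γ ⥤ DiscreteRepCat k (Γ ⧸ N) :=
  (isDiscrete k (Γ ⧸ N)).lift (invariantsQuotFunctor k N)
    fun X => isDiscrete_quotientToInvariants N X.obj X.property

/-- `invariantsQuotD ⋙ ι = invariantsQuotFunctor` (definitionally). [cite: Harari2020, §4.3 Remark 4.24] -/
def invariantsQuotDCompιIso : invariantsQuotD k N ⋙ ι k (Γ ⧸ N) ≅ invariantsQuotFunctor k N := Iso.refl _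

/-- On objects: the underlying representation of `invariantsQuotD X` is `X.obj^N` (definitional).
[cite: Harari2020, §4.3 Remark 4.24] -/
theorem invariantsQuotD_obj_obj (X : DiscreteRepCat k Γ) :
    ((invariantsQuotD k N).obj X).obj = X.obj.quotientToInvariants N := rfl

/-- On morphisms: `invariantsQuotD f` is `f` restricted to invariants (definitional). [cite: Harari2020, §4.3 Remark 4.24] -/
@[simp]
theorem invariantsQuotD_map_hom_hom_coe {X Y : DiscreteRepCat k Γ} (f : X ⟶ Y) (x : (X.obj.quotientToInvariants N).V) :
    (((invariantsQuotD k N).map f).hom.hom x).1 = f.hom.hom x.1 := rfl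

/-- The `Γ ⧸ N`-action on `X^N` on classes: `[γ] • x = γ • x` (definitional). [cite: SerreGaloisCohomology1997, I §2.6] -/
theorem invariantsQuotD_obj_ρ_mk_coe (X : DiscreteRepCat k Γ) (γ : Γ) (x : (X.obj.quotientToInvariants N).V) :
    (((invariantsQuotD k N).obj X).obj.ρ (QuotientGroup.mk γ) x).1 = X.obj.ρ γ x.1 := rfl

/-- `invariantsQuotD` is an additive functor. [cite: Harari2020, §4.3 Remark 4.24] -/
instance invariantsQuotD_additive : (invariantsQuotD k N).Additive :=
  ⟨fun {_ _ _ _} => ObjectProperty.hom_ext _ (Rep.hom_ext (DFunLike.ext _ _ fun _ => Subtype.ext rfl))⟩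

/-- `inflQuotFunctor` (inflation of discrete representations along `Γ ↠ Γ ⧸ N`) is an additive functor.
[cite: Harari2020, §4.3 Remark 4.24] -/
instance inflQuotFunctor_additive : (inflQuotFunctor k N).Additive :=
  ⟨fun {_ _ _ _} => ObjectProperty.hom_ext _ (Rep.hom_ext (DFunLike.ext _ _ fun _ => rfl))⟩

/-! ## §3 Elementwise exactness in `C_Γ` (any `Γ`, `k`) and exactness of `X ↦ X^N` on `N`-trivial modules -/

/-- **Elementwise exactness in `C_Γ`**: for an exact `S`, a vector of `S.X₂` killed by `S.g` comes from `S.X₁`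
(the inclusions `C_Γ ⥤ Rep k Γ ⥤ Mod_k` are exact and faithful). [cite: Harari2020, §4.2] -/
theorem exact_apply {S : ShortComplex (DiscreteRepCat k Γ)} (hS : S.Exact)
    (y : S.X₂.obj.V) (hy : S.g.hom.hom y = 0) : ∃ x : S.X₁.obj.V, S.f.hom.hom x = y := by
  haveI : (ι k Γ).PreservesHomology :=
    ⟨fun _ _ f => (isDiscrete k Γ).preservesKernels_ι f, fun _ _ f => (isDiscrete k Γ).preservesCokernels_ι f⟩
  have h := hS
  rw [← ShortComplex.exact_map_iff_of_faithful _ (ι k Γ),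
    ← ShortComplex.exact_map_iff_of_faithful _ (forget₂ (Rep.{u} k Γ) (ModuleCat.{u} k)),
    ShortComplex.moduleCat_exact_iff] at h
  obtain ⟨x, hx⟩ := h y hy
  exact ⟨x, hx⟩

omit [IsTopologicalGroup Γ] in
/-- For a short exact `S` in `C_Γ`, `S.f` is injective on vectors. [cite: Harari2020, §4.2] -/
theorem shortExact_f_injective {S : ShortComplex (DiscreteRepCat k Γ)} (hS : S.ShortExact) :
    Function.Injective S.f.hom.hom :=
  (Rep.mono_iff_injective ((ι k Γ).map S.f)).1 (by haveI := hS.mono_f; infer_instance)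

/-- For a short exact `S` in `C_Γ`, `S.g` is surjective on vectors. [cite: Harari2020, §4.2] -/
theorem shortExact_g_surjective {S : ShortComplex (DiscreteRepCat k Γ)} (hS : S.ShortExact) :
    Function.Surjective S.g.hom.hom :=
  (Rep.epi_iff_surjective ((ι k Γ).map S.g)).1 (by haveI := hS.epi_g; infer_instance)

omit [IsTopologicalGroup Γ] in
/-- For a complex `S` in `C_Γ`, `S.g (S.f x) = 0` on vectors. [cite: Harari2020, §4.2] -/
theorem shortComplex_g_f_apply (S : ShortComplex (DiscreteRepCat k Γ)) (x : S.X₁.obj.V) :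
    S.g.hom.hom (S.f.hom.hom x) = 0 := by
  change (S.f ≫ S.g).hom.hom x = 0
  rw [S.zero]
  rfl

omit [N.Normal] [IsTopologicalGroup Γ] in
/-- If `N` acts trivially on `S.X₂` and `S.g` is surjective on vectors then `N` acts trivially on `S.X₃`.
[cite: SerreGaloisCohomology1997, I §2.6] -/
theorem trivial_X₃_of_trivial_X₂ (S : ShortComplex (DiscreteRepCat k Γ)) (hg : Function.Surjective S.g.hom.hom)
    (hN : ∀ n ∈ N, ∀ x : S.X₂.obj.V, S.X₂.obj.ρ n x = x) :
    ∀ n ∈ N, ∀ z : S.X₃.obj.V, S.X₃.obj.ρ n z = z := fun n hn z => by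
  obtain ⟨y, rfl⟩ := hg z
  rw [← Rep.hom_comm_apply, hN n hn y]

omit [N.Normal] [IsTopologicalGroup Γ] in
/-- If `N` acts trivially on `S.X₂` and `S.f` is injective on vectors then `N` acts trivially on `S.X₁`.
[cite: SerreGaloisCohomology1997, I §2.6] -/
theorem trivial_X₁_of_trivial_X₂ (S : ShortComplex (DiscreteRepCat k Γ)) (hf : Function.Injective S.f.hom.hom)
    (hN : ∀ n ∈ N, ∀ x : S.X₂.obj.V, S.X₂.obj.ρ n x = x) :
    ∀ n ∈ N, ∀ z : S.X₁.obj.V, S.X₁.obj.ρ n z = z := fun n hn z =>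
  hf (by
    have h := Rep.hom_comm_apply S.f.hom n z
    rw [hN n hn] at h
    exact h)

/-- **`X ↦ X^N` is exact on short exact sequences with trivial `N`-action**: for `0 → X₁ → X₂ → X₃ → 0` short exact in
`C_Γ` with `N` acting trivially on `X₂`, `0 → X₁^N → X₂^N → X₃^N → 0` is short exact in `C_{Γ/N}`.
[cite: SerreGaloisCohomology1997, I §2.6] [cite: Harari2020, §4.3 Remark 4.24] -/
theorem shortExact_map_invariantsQuotD {S : ShortComplex (DiscreteRepCat k Γ)} (hS : S.ShortExact)
    (hN : ∀ n ∈ N, ∀ x : S.X₂.obj.V, S.X₂.obj.ρ n x = x) :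
    (S.map (invariantsQuotD k N)).ShortExact where
  exact := by
    refine shortComplex_exact_of_forall _ _ _ fun y hy => ?_
    have hy' : S.g.hom.hom y.1 = 0 := congrArg Subtype.val hy
    obtain ⟨x, hx⟩ := exact_apply hS.exact y.1 hy'
    refine ⟨⟨x, fun n => trivial_X₁_of_trivial_X₂ N S (shortExact_f_injective hS) hN n.1 n.2 x⟩, Subtype.ext hx⟩
  mono_f := by
    apply (ι k (Γ ⧸ N)).mono_of_mono_map
    rw [Rep.mono_iff_injective]
    intro a b h
    exact Subtype.ext (shortExact_f_injective hS (congrArg Subtype.val h))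
  epi_g := by
    apply (ι k (Γ ⧸ N)).epi_of_epi_map
    rw [Rep.epi_iff_surjective]
    intro z
    obtain ⟨y, hy⟩ := shortExact_g_surjective hS z.1
    exact ⟨⟨y, fun n => hN n.1 n.2 y⟩, Subtype.ext hy⟩

/-! ## §4 The counit `Inf(X^N) ⟶ X` -/

/-- **The inclusion `Inf(X^N) ⟶ X` in `C_Γ`** (the counit of `Inf ⊣ (·)^N`, `x ↦ x.1`).
[cite: Harari2020, §4.3 Remark 4.24] -/
def invariantsInclQuot (X : DiscreteRepCat k Γ) :
    (inflQuotFunctor k N).obj ((invariantsQuotD k N).obj X) ⟶ X :=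
  ObjectProperty.homMk (homInfOfInvariants N _ X.obj (𝟙 _))

/-- Formula: `invariantsInclQuot` is `x ↦ x.1`. [cite: Harari2020, §4.3 Remark 4.24] -/
@[simp]
theorem invariantsInclQuot_hom_hom_apply (X : DiscreteRepCat k Γ) (x : (X.obj.quotientToInvariants N).V) :
    (invariantsInclQuot N X).hom.hom x = x.1 := rfl

/-- `invariantsInclQuot` is a monomorphism. [cite: Harari2020, §4.3 Remark 4.24] -/
theorem mono_invariantsInclQuot (X : DiscreteRepCat k Γ) : Mono (invariantsInclQuot N X) := by
  apply (ι k Γ).mono_of_mono_map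
  rw [Rep.mono_iff_injective]
  intro x y h
  exact Subtype.ext h

/-- **Naturality of the counit**: `Inf((f)^N) ≫ incl_Y = incl_X ≫ f`. [cite: Harari2020, §4.3 Remark 4.24] -/
theorem invariantsInclQuot_naturality {X Y : DiscreteRepCat k Γ} (f : X ⟶ Y) :
    (inflQuotFunctor k N).map ((invariantsQuotD k N).map f) ≫ invariantsInclQuot N Y = invariantsInclQuot N X ≫ f :=
  ObjectProperty.hom_ext _ (Rep.hom_ext (DFunLike.ext _ _ fun _ => rfl))

/-- When `N` acts trivially on `X`, `invariantsInclQuot` is surjective on vectors. [cite: SerreGaloisCohomology1997, I §2.6] -/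
theorem invariantsInclQuot_surjective (X : DiscreteRepCat k Γ) (hN : ∀ n ∈ N, ∀ x : X.obj.V, X.obj.ρ n x = x) :
    Function.Surjective (invariantsInclQuot N X).hom.hom := fun x =>
  ⟨⟨x, fun n => hN n.1 n.2 x⟩, rfl⟩

/-- **When `N` acts trivially on `X`, `Inf(X^N) ⟶ X` is an isomorphism in `C_Γ`.** [cite: SerreGaloisCohomology1997, I §2.6] -/
theorem isIso_invariantsInclQuot (X : DiscreteRepCat k Γ) (hN : ∀ n ∈ N, ∀ x : X.obj.V, X.obj.ρ n x = x) :
    IsIso (invariantsInclQuot N X) := by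
  haveI : Mono (invariantsInclQuot N X) := mono_invariantsInclQuot N X
  haveI : Epi (invariantsInclQuot N X) := by
    apply (ι k Γ).epi_of_epi_map
    rw [Rep.epi_iff_surjective]
    exact invariantsInclQuot_surjective N X hN
  exact isIso_of_mono_of_epi _

/-- **`Inf(X^N) ≅ X` for `N` acting trivially on `X`.** [cite: SerreGaloisCohomology1997, I §2.6] -/
def inflInvariantsIso (X : DiscreteRepCat k Γ) (hN : ∀ n ∈ N, ∀ x : X.obj.V, X.obj.ρ n x = x) :
    (inflQuotFunctor k N).obj ((invariantsQuotD k N).obj X) ≅ X :=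
  haveI := isIso_invariantsInclQuot N X hN
  asIso (invariantsInclQuot N X)

/-- `(inflInvariantsIso X hN).hom = invariantsInclQuot N X`. [cite: SerreGaloisCohomology1997, I §2.6] -/
@[simp]
theorem inflInvariantsIso_hom (X : DiscreteRepCat k Γ) (hN : ∀ n ∈ N, ∀ x : X.obj.V, X.obj.ρ n x = x) :
    (inflInvariantsIso N X hN).hom = invariantsInclQuot N X := rfl

/-- The inverse followed by the inclusion is the identity on vectors: `((e.inv) x).1 = x`.
[cite: SerreGaloisCohomology1997, I §2.6] -/
theorem invariantsInclQuot_inflInvariantsIso_inv_apply (X : DiscreteRepCat k Γ)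
    (hN : ∀ n ∈ N, ∀ x : X.obj.V, X.obj.ρ n x = x) (x : X.obj.V) :
    (invariantsInclQuot N X).hom.hom ((inflInvariantsIso N X hN).inv.hom.hom x) = x := by
  change ((inflInvariantsIso N X hN).inv ≫ invariantsInclQuot N X).hom.hom x = x
  rw [← inflInvariantsIso_hom N X hN, Iso.inv_hom_id]
  rfl

end DiscreteRep

end Literature.Algebra.Homology
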